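import Summits.Ventures.Crystal3D.Theorems.StickyWulffConstantPolycrystalWulffBoundBasalLamellarFrames
import Summits.Ventures.Crystal3D.Theorems.StickyWulffConstantPolycrystalWulffBoundFreeEnergyExterior

/-!
# `PolycrystalWulffBound`, rung `rung_twinCaps` — step 0: co-axial frames have Wulff bodies with equal
# CAP VOLUMES along the common axis (line `PolyDensity`, crux `stmt-Ventures-19482`)

Route `StickyWulffConstant` of the venture `Summits/Ventures/Crystal3D`, second prover lane (poly-p2,
gen 12).  If two frames `A`, `B` both satisfy the crux's self-clause about the axis `m` (each lattice is
embedded in a Barlow stacking of axis `m` — in particular when `Ax m A B` holds, i.e. `B` carries the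
lattice of `A` or its coherent twin across the basal plane `⊥ m`), then for every height `s`

  `|W(B) ∩ {s < ⟪y, m⟫}| = |W(A) ∩ {s < ⟪y, m⟫}|`

(`volume_cruxWulffBody_inter_eq_of_coaxial`): by `exists_frame_cruxWulffBody`, `W(B) = N '' W(A)` for
a linear isometry `N` with `N m = ±m`, and the sign is absorbed by the central symmetry `−W(A) = W(A)`.
This is the one property of twin bodies used by the piecewise Brunn–Minkowski lower bound
`twinCaps_chimera_lower` (`…TwinCapsChimera.lean`): it makes the proportional quantile targets of the
parent and of the caps fit into ONE body volume `32`.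
WHAT THIS IS NOT: equal SECTIONS (true as well, `volume_slice3_image_eq`, not needed); the crux is not
claimed.
-/

noncomputable section

open scoped BigOperators InnerProductSpace ENNReal Pointwise
open MeasureTheory Set

namespace Summit.Ventures.Crystal3D.Theorems

open Summit.Ventures.Crystal3D.Cruxes.TextureLiminf.TexShadow (E3)
open Literature.MathematicalPhysics.StatisticalMechanics (fccStacking barlowStacking IsHaggSeq)

/-! ### Cap volumes of co-axial bodies -/

/-- **Co-axial frames have bodies with equal cap volumes along the common axis.**  If the frames
`A`, `B` both satisfy the crux's self-clause about the axis `m` (each is embedded in a Barlow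
stacking of axis `m`), then for every height `s` the caps `W(A) ∩ {s < ⟪y, m⟫}` and
`W(B) ∩ {s < ⟪y, m⟫}` have the same volume: `W(B) = N '' W(A)` for a linear isometry `N` with
`N m = ±m` (`exists_frame_cruxWulffBody`), and the sign is absorbed by the central symmetry
`−W(A) = W(A)`. -/
theorem volume_cruxWulffBody_inter_eq_of_coaxial {m : E3} {A B : E3 ≃ₗᵢ[ℝ] E3}
    (hA : ∃ (L : E3 ≃ₗᵢ[ℝ] E3) (s₁ s₂ : E3) (σ σ' : ℤ → ℤ), IsHaggSeq σ ∧ IsHaggSeq σ' ∧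
      L (EuclideanSpace.single (2 : Fin 3) (1 : ℝ)) = m ∧
      A '' fccStacking 1 (Real.sqrt (2 / 3)) ⊆
        (fun q => L q + s₁) '' barlowStacking 1 (Real.sqrt (2 / 3)) σ ∧
      A '' fccStacking 1 (Real.sqrt (2 / 3)) ⊆
        (fun q => L q + s₂) '' barlowStacking 1 (Real.sqrt (2 / 3)) σ')
    (hB : ∃ (L : E3 ≃ₗᵢ[ℝ] E3) (s₁ s₂ : E3) (σ σ' : ℤ → ℤ), IsHaggSeq σ ∧ IsHaggSeq σ' ∧
      L (EuclideanSpace.single (2 : Fin 3) (1 : ℝ)) = m ∧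
      B '' fccStacking 1 (Real.sqrt (2 / 3)) ⊆
        (fun q => L q + s₁) '' barlowStacking 1 (Real.sqrt (2 / 3)) σ ∧
      B '' fccStacking 1 (Real.sqrt (2 / 3)) ⊆
        (fun q => L q + s₂) '' barlowStacking 1 (Real.sqrt (2 / 3)) σ') (s : ℝ) :
    volume ({y : E3 | ∀ ν : E3, ⟪y, ν⟫_ℝ ≤ Real.sqrt 2 / 4 *
        ∑ᶠ w ∈ {w | w ∈ fccStacking 1 (Real.sqrt (2 / 3)) ∧ ‖w‖ = 1}, |⟪w, B.symm ν⟫_ℝ|} ∩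
        {y : E3 | s < ⟪y, m⟫_ℝ}) =
      volume ({y : E3 | ∀ ν : E3, ⟪y, ν⟫_ℝ ≤ Real.sqrt 2 / 4 *
        ∑ᶠ w ∈ {w | w ∈ fccStacking 1 (Real.sqrt (2 / 3)) ∧ ‖w‖ = 1}, |⟪w, A.symm ν⟫_ℝ|} ∩
        {y : E3 | s < ⟪y, m⟫_ℝ}) := by
  classical
  set e₂ : E3 := EuclideanSpace.single (2 : Fin 3) (1 : ℝ) with he₂
  set W₁ : Set E3 := {y : E3 | ∀ ν : E3, ⟪y, ν⟫_ℝ ≤ Real.sqrt 2 / 4 *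
    ∑ᶠ w ∈ {w | w ∈ fccStacking 1 (Real.sqrt (2 / 3)) ∧ ‖w‖ = 1},
      |⟪w, (LinearIsometryEquiv.refl ℝ E3).symm ν⟫_ℝ|} with hW₁
  set WA : Set E3 := {y : E3 | ∀ ν : E3, ⟪y, ν⟫_ℝ ≤ Real.sqrt 2 / 4 *
    ∑ᶠ w ∈ {w | w ∈ fccStacking 1 (Real.sqrt (2 / 3)) ∧ ‖w‖ = 1}, |⟪w, A.symm ν⟫_ℝ|} with hWA
  set WB : Set E3 := {y : E3 | ∀ ν : E3, ⟪y, ν⟫_ℝ ≤ Real.sqrt 2 / 4 *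
    ∑ᶠ w ∈ {w | w ∈ fccStacking 1 (Real.sqrt (2 / 3)) ∧ ‖w‖ = 1}, |⟪w, B.symm ν⟫_ℝ|} with hWB
  obtain ⟨M, hM, hMe⟩ := exists_frame_cruxWulffBody hA
  obtain ⟨M', hM', hM'e⟩ := exists_frame_cruxWulffBody hB
  -- `W(B) = N '' W(A)` with `N = M' ∘ M⁻¹`, `N m = ε m`
  set N : E3 ≃ₗᵢ[ℝ] E3 := M.symm.trans M' with hN
  have hWBN : WB = N '' WA := by
    have h1 : (M.symm : E3 → E3) '' WA = W₁ := by
      rw [show WA = M '' W₁ from hM, Set.image_image]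
      simp only [LinearIsometryEquiv.symm_apply_apply, Set.image_id']
    show WB = N '' WA
    rw [hN, LinearIsometryEquiv.coe_trans, Set.image_comp, h1]
    exact hM'
  have hMsymm : M.symm m = e₂ ∨ M.symm m = -e₂ := by
    rcases hMe with h | h
    · left; rw [← h, LinearIsometryEquiv.symm_apply_apply]
    · right
      have : M (-e₂) = m := by rw [map_neg, h, neg_neg]
      rw [← this, LinearIsometryEquiv.symm_apply_apply]
  have hNm : ∃ ε : ℝ, (ε = 1 ∨ ε = -1) ∧ N m = ε • m := by
    have hN1 : N m = M' (M.symm m) := rfl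
    rcases hMsymm with h1 | h1 <;> rcases hM'e with h2 | h2
    · exact ⟨1, Or.inl rfl, by rw [hN1, h1, h2, one_smul]⟩
    · exact ⟨-1, Or.inr rfl, by rw [hN1, h1, h2, neg_one_smul]⟩
    · exact ⟨-1, Or.inr rfl, by rw [hN1, h1, map_neg, h2, neg_one_smul]⟩
    · exact ⟨1, Or.inl rfl, by rw [hN1, h1, map_neg, h2, neg_neg, one_smul]⟩
  obtain ⟨ε, hε, hNm⟩ := hNm
  have hε2 : ε * ε = 1 := by rcases hε with rfl | rfl <;> norm_num
  -- `⟪N y, m⟫ = ε ⟪y, m⟫`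
  have hinner : ∀ y : E3, ⟪N y, m⟫_ℝ = ε * ⟪y, m⟫_ℝ := by
    intro y
    have h1 : ⟪N y, N m⟫_ℝ = ⟪y, m⟫_ℝ := LinearIsometryEquiv.inner_map_map N y m
    rw [hNm, inner_smul_right] at h1
    calc ⟪N y, m⟫_ℝ = (ε * ε) * ⟪N y, m⟫_ℝ := by rw [hε2, one_mul]
      _ = ε * (ε * ⟪N y, m⟫_ℝ) := by ring
      _ = ε * ⟪y, m⟫_ℝ := by rw [h1]
  -- the cap of `W(B)` is the `N`-image of the cap `{s < ε ⟪y, m⟫}` of `W(A)`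
  have hcapB : WB ∩ {y : E3 | s < ⟪y, m⟫_ℝ} = N '' (WA ∩ {y : E3 | s < ε * ⟪y, m⟫_ℝ}) := by
    rw [hWBN]
    ext z
    simp only [mem_inter_iff, mem_image, mem_setOf_eq]
    constructor
    · rintro ⟨⟨y, hy, rfl⟩, hz⟩
      exact ⟨y, ⟨hy, by rwa [hinner] at hz⟩, rfl⟩
    · rintro ⟨y, ⟨hy, hz⟩, rfl⟩
      exact ⟨⟨y, hy, rfl⟩, by rwa [hinner]⟩
  have hWAc : IsCompact WA := isCompact_cruxWulffBody A
  have hWAm : MeasurableSet WA := hWAc.isClosed.measurableSet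
  have hlt_m : ∀ c : ℝ, MeasurableSet {y : E3 | s < c * ⟪y, m⟫_ℝ} := fun c =>
    (isOpen_lt continuous_const (continuous_const.mul (continuous_id.inner continuous_const))).measurableSet
  have hvolN : volume (N '' (WA ∩ {y : E3 | s < ε * ⟪y, m⟫_ℝ})) =
      volume (WA ∩ {y : E3 | s < ε * ⟪y, m⟫_ℝ}) := by
    rw [LinearIsometryEquiv.image_eq_preimage_symm]
    exact N.symm.measurePreserving.measure_preimage
      (hWAm.inter (hlt_m ε)).nullMeasurableSet
  show volume (WB ∩ {y : E3 | s < ⟪y, m⟫_ℝ}) = volume (WA ∩ {y : E3 | s < ⟪y, m⟫_ℝ})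
  rw [hcapB, hvolN]
  rcases hε with rfl | rfl
  · simp only [one_mul]
  · -- the sign: central symmetry of `W(A)`
    have hneg : WA ∩ {y : E3 | s < -1 * ⟪y, m⟫_ℝ} = -(WA ∩ {y : E3 | s < ⟪y, m⟫_ℝ}) := by
      have hWAs : -WA = WA := neg_cruxWulffBody_eq A
      ext y
      simp only [mem_inter_iff, Set.mem_neg, mem_setOf_eq, inner_neg_left, neg_one_mul]
      constructor
      · rintro ⟨hy, hs⟩
        refine ⟨?_, hs⟩
        have : -y ∈ -WA := by rwa [Set.neg_mem_neg]
        rwa [hWAs] at this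
      · rintro ⟨hy, hs⟩
        refine ⟨?_, hs⟩
        have : y ∈ -WA := Set.mem_neg.2 hy
        rwa [hWAs] at this
    rw [hneg, Measure.measure_neg]


end Summit.Ventures.Crystal3D.Theorems

end
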